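import Mathlib
import HarnessLib
import Literature.Analysis.FluidPDE.SuitableWeak
import Literature.Analysis.FluidPDE.LocalTypeI
import Summits.NavierStokesRegularity.NavierStokesRegularity.Theorems.TypeIQuarterGateScarEnvelopeTypeITopTimeCKN

/-!
# Crux `TypeIQuarterGate.ScarEnvelopeTypeI` (stmt-NavierStokesRegularity-23843), line `slice_budget` —
# CKN AT THE TOP TIME, file 3: the energy bound may vary from vertex to vertex

Third helper file (no new definitions) of the top-time CKN tool (`…TopEpsilonRegularity.lean` p620112,
`…TopTimeCKN.lean` p620447).  `hausdorffMeasure_topSingular_eq_zero` asks for ONE constant `K` bounding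
the scaled energies `A(ρ; (t₀, x))` at all vertices `x ∈ S`; here the bound is allowed to depend on the
vertex (`∀ x ∈ S, ∃ K, …`), which is the form a per-vertex application of Seregin–Šverák's Lemma 3.5
(`scaledEnergies_bounded_of_typeIRate`) delivers for objects known only ball by ball.  Proof:
stratify `S = ⋃ₘ Sₘ`, `Sₘ = {x ∈ S : A(ρ; (t₀,x)) ≤ m for 0 < ρ ≤ R₀}`, apply file 2 to each stratum,
and use countable subadditivity of `μH[1]`.

HONEST FRAMING: tools only; SK, SD, the crux `ScarEnvelopeTypeI`, its parent and the summit are OPEN.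
-/

noncomputable section

-- the summit-side namespace `Summit.NavierStokesRegularity.NavierStokesRegularity.…` (single-conjunct
-- summit, D-0017) repeats a component by design; the dupNamespace linter would flag every declaration.
set_option linter.dupNamespace false

namespace Summit.NavierStokesRegularity.NavierStokesRegularity.Cruxes.ScarEnvelopeTypeI.SliceBudget

open MeasureTheory Set Function Filter Topology TopologicalSpace Metric
open scoped NNReal ENNReal
open Literature.Analysis Literature.Analysis.FluidPDE

/-- **Top-time singular sets are `H¹`-null — vertex-dependent energy bounds.**  As
`hausdorffMeasure_topSingular_eq_zero`, but the scaled-energy bound `A(ρ; (t₀, x)) ≤ K_x` (`0 < ρ ≤ R₀`)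
may depend on the vertex `x ∈ S`. -/
theorem hausdorffMeasure_topSingular_eq_zero_pointwise
    {Q : Opens (ℝ × EuclideanSpace ℝ (Fin 3))}
    {u : ℝ → EuclideanSpace ℝ (Fin 3) → EuclideanSpace ℝ (Fin 3)}
    {p : ℝ → EuclideanSpace ℝ (Fin 3) → ℝ}
    {G : ℝ → EuclideanSpace ℝ (Fin 3) → EuclideanSpace ℝ (Fin 3) →L[ℝ] EuclideanSpace ℝ (Fin 3)}
    (hsw : IsSuitableWeakSolutionOn Q 1 0 u p) (hG : HasWeakSpatialGradientOn Q u G)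
    {t₀ R₀ : ℝ} (hR₀ : 0 < R₀) {U : Set (EuclideanSpace ℝ (Fin 3))}
    (hslab : Ioo (t₀ - R₀ ^ 2) t₀ ×ˢ U ⊆ (Q : Set (ℝ × EuclideanSpace ℝ (Fin 3))))
    (hUm : MeasurableSet U) (hUvol : volume U ≠ ∞)
    (hgrad : ∫⁻ w in Ioo (t₀ - R₀ ^ 2) t₀ ×ˢ U, ENNReal.ofReal (frobeniusNormSq (G w.1 w.2)) ≠ ∞)
    {S : Set (EuclideanSpace ℝ (Fin 3))} (hSU : ∀ x ∈ S, ball x R₀ ⊆ U)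
    (hA : ∀ x ∈ S, ∃ K : ℝ≥0, ∀ ρ, 0 < ρ → ρ ≤ R₀ →
      cknAEss ρ ((t₀, x) : ℝ × EuclideanSpace ℝ (Fin 3)) u ≤ K)
    (hD : ∀ x ∈ S, ∀ ρ, 0 < ρ → ρ ≤ R₀ → cknD ρ ((t₀, x) : ℝ × EuclideanSpace ℝ (Fin 3)) p ≠ ∞)
    (hS : ∀ x ∈ S, IsBackwardSingularPoint u ((t₀, x) : ℝ × EuclideanSpace ℝ (Fin 3))) :
    μH[1] S = 0 := by
  -- the strata `S m = {x ∈ S | A(ρ; (t₀,x)) ≤ m}`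
  set Sm : ℕ → Set (EuclideanSpace ℝ (Fin 3)) := fun m =>
    {x ∈ S | ∀ ρ, 0 < ρ → ρ ≤ R₀ → cknAEss ρ ((t₀, x) : ℝ × EuclideanSpace ℝ (Fin 3)) u ≤ (m : ℝ≥0)}
    with hSm
  have hcover : S ⊆ ⋃ m : ℕ, Sm m := by
    intro x hx
    obtain ⟨K, hK⟩ := hA x hx
    obtain ⟨m, hm⟩ := exists_nat_ge (K : ℝ)
    refine mem_iUnion.2 ⟨m, hx, fun ρ hρ hρR => (hK ρ hρ hρR).trans ?_⟩
    exact_mod_cast hm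
  have hnull : ∀ m : ℕ, μH[1] (Sm m) = 0 := fun m =>
    hausdorffMeasure_topSingular_eq_zero hsw hG hR₀ hslab hUm hUvol hgrad
      (fun x hx => hSU x hx.1) (K := (m : ℝ≥0)) (fun x hx => hx.2) (fun x hx => hD x hx.1)
      (fun x hx => hS x hx.1)
  exact measure_mono_null hcover ((measure_iUnion_null_iff).2 hnull)

end Summit.NavierStokesRegularity.NavierStokesRegularity.Cruxes.ScarEnvelopeTypeI.SliceBudget

end
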